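import Mathlib
import Literature.Analysis.FluidPDE.Tao2016AveragedNS.ShiftSetCascadeFlows
import Summits.NavierStokesRegularity.NavierStokesRegularity.Theorems.TaoLadderRungTwoFlatCertificateGlueLohnerCascadePerCompOn
import HarnessLib

/-!
# Certificate glue on a shift set `𝕊`, XIV-d / XIX-d: BOOTSTRAP REGION — `StepCert` from an exact-flow tube (XIV-c) or a
  per-component Lohner step (XIX-c) with the Lipschitz / input-defect region required only around the VALIDATED TUBE
  (`Tube u ⊕ A'·ω ⊆ G`, `A < A'`), not around the a priori `M`-box (helper for items stmt-NavierStokesRegularity-22987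
  `FlatGapCertificatesV2` (crux K_A♭ of route TaoLadderRungTwoFlat) and stmt-24295 K_A₂(64); cell harvest/h2-tao-ladder,
  p1 g15; theory-1 ask R8(a), bus l.505)

Glue XIV / XIV-b / XIV-c take the Lipschitz constant `K` and the input defect `δ` on a region `G ⊇` the a priori `M`-box
of the trapping clause (so that the RUN is known to lie in `G` without a first-exit argument), and glue XIX / XIX-c take
them on the weighted `R`-ball with `M ≤ R·ω`. theory-1's screen NUM-T41h (bus l.505): with the certificate's ONE global
`M`-table this costs ×285–×4.7e4 on the transit hops (the table exceeds the validated time-sweep boxes by 2e5–1e12), i.e.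
it is the binding cost; with the region shrunk to the validated tube the unfloored numbers (0.15–0.63 of the allowance)
apply. This module removes the `M`-box from the region by CONTINUOUS INDUCTION (first exit):

* `stepCert_of_flowTube_local` — glue XIV-c with `hGM`/`hGT` replaced by `hGT' : Tube u ⊕ A'·ω ⊆ G` (componentwise on
  the window) and `hAA' : A < A'`. Proof: the weighted sup distance `d(u)` between the run and the exact solution is
  continuous with `d(0) = 0`; if `d ≥ A'` somewhere, at the first such time `u*` the run has stayed in `G` on `[0,u*)`,
  so Grönwall (Mathlib `dist_le_of_approx_trajectories_ODE_of_mem`, region condition on `Ico`) gives `d(u*) ≤ A < A'` —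
  contradiction; hence the run stays in `G` on `[0,s)` and Grönwall applies on the whole step.
* `stepCert_of_plohner_local` / `stepCert_of_plohner_local_approx` — glue XIX-c with `hMR : M ≤ R·ω` replaced by
  `hR : R_h + A' ≤ R` (`R_h` the majorant radius): the region ball only has to contain the majorant ball fattened by `A'`.

HONEST FRAMING: Tao-type MODEL lattices (Tao 2016 §4/§6 vocabulary, shift-set parametrised); every enclosure / bound is
a HYPOTHESIS — nothing is computed or certified here, no stub is closed, nothing about the Navier–Stokes equations.
-/

noncomputable section

-- the sub-problem namespace repeats the summit name by design (D-0017)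
set_option linter.dupNamespace false

namespace Summit.NavierStokesRegularity.NavierStokesRegularity.Theorems

open Set Filter Topology Literature.Analysis.FluidPDE Literature.Analysis.FluidPDE.TaoCascade
open Summit.NavierStokesRegularity.NavierStokesRegularity.Theorems.TaylorModelReadout

namespace CertificateGlueOn

variable {m : ℕ} {Kb Ka : ℤ} {ω : Fin m → ℤ → ℝ}
  {𝕊 : Finset (ℤ × ℤ × ℤ)} {ε₀ : ℝ} {α : Fin m → Fin m → Fin m → ℤ × ℤ × ℤ → ℝ} {Eb Et : ℝ}

/-! ### XIV-d: the exact-flow tube with a bootstrap region -/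

/-- The Grönwall allowance from zero initial distance is nonnegative (any sign of `K`). [folklore] -/
theorem gronwallBound_nonneg_of_zero {K ε x : ℝ} (hε : 0 ≤ ε) (hx : 0 ≤ x) : 0 ≤ gronwallBound 0 K ε x := by
  rcases eq_or_ne K 0 with hK | hK
  · rw [hK, gronwallBound_K0]; positivity
  · rw [gronwallBound_of_K_ne_0 hK]
    simp only [zero_mul, zero_add]
    rcases lt_or_gt_of_ne hK with hneg | hpos
    · have h1 : ε / K ≤ 0 := div_nonpos_of_nonneg_of_nonpos hε hneg.le
      have h2 : Real.exp (K * x) - 1 ≤ 0 := by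
        have : Real.exp (K * x) ≤ 1 := Real.exp_le_one_iff.mpr (by nlinarith)
        linarith
      exact mul_nonneg_of_nonpos_of_nonpos h1 h2
    · have h1 : 0 ≤ ε / K := div_nonneg hε hpos.le
      have h2 : 0 ≤ Real.exp (K * x) - 1 := by
        have : 1 ≤ Real.exp (K * x) := Real.one_le_exp (by positivity)
        linarith
      exact mul_nonneg h1 h2

/-- **`StepCert` FROM AN EXACT-FLOW STEP IN A TUBE, REGION AROUND THE TUBE ONLY** (glue XIV-c with the a priori
`M`-box removed from the Lipschitz / input-defect region by a first-exit argument; see the module docstring).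
[cite: MooreKearfottCloud2009, §9–10 (interval enclosure of ODE solutions); cell certificate format, mesh layer] -/
theorem stepCert_of_flowTube_local (hKb : 0 ≤ Kb) (hKa : 1 ≤ Ka) (hω : ∀ i k, 0 < ω i k)
    {M : ℤ → ℝ} {t : ℕ → ℝ} {Node Hull : ℕ → (Fin m → ℤ → ℝ) → Prop} {j : ℕ}
    {Start Land : (Fin m → ℤ → ℝ) → Prop} {Tube : ℝ → (Fin m → ℤ → ℝ) → Prop}
    {glo ghi : Fin m → ℤ → ℝ} {K δ A A' : ℝ} (hK : 0 ≤ K) (hδ : 0 ≤ δ) (hAA' : A < A')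
    (hN : ∀ y, Node j y → Start y)
    (hGT' : ∀ u ∈ Icc 0 (t (j + 1) - t j), ∀ p y : Fin m → ℤ → ℝ, Tube u p →
      (∀ i k, -Kb ≤ k → k ≤ Ka → |y i k - p i k| ≤ A' * ω i k) → InBoxOn Kb Ka glo ghi y)
    (hlip : PFieldLipOn 𝕊 ε₀ α Kb Ka ω glo ghi K) (hdef : PInputDefectOn 𝕊 ε₀ α Kb Ka Eb Et ω glo ghi δ)
    (hflow : ∀ z : Fin m → ℤ → ℝ, Start z → ∃ ψ : Fin m → ℤ → ℝ → ℝ,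
      (∀ i k, -Kb ≤ k → k ≤ Ka → ψ i k 0 = z i k) ∧
      (∀ i k, -Kb ≤ k → k ≤ Ka → ∀ u ∈ Icc 0 (t (j + 1) - t j),
        HasDerivWithinAt (ψ i k) (truncField 𝕊 ε₀ α Kb Ka (slice ψ u) i k) (Icc 0 (t (j + 1) - t j)) u) ∧
      (∀ u ∈ Icc 0 (t (j + 1) - t j), Tube u (slice ψ u)) ∧
      Land (slice ψ (t (j + 1) - t j)))
    (hA : gronwallBound 0 K δ (t (j + 1) - t j) ≤ A)
    (hH : ∀ u ∈ Icc 0 (t (j + 1) - t j), ∀ y p : Fin m → ℤ → ℝ, Tube u p →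
      (∀ i k, -Kb ≤ k → k ≤ Ka → |y i k - p i k| ≤ A * ω i k) → Hull j y)
    (hN' : ∀ y p : Fin m → ℤ → ℝ, Land p →
      (∀ i k, -Kb ≤ k → k ≤ Ka → |y i k - p i k| ≤ A * ω i k) → Node (j + 1) y) :
    StepCert 𝕊 ε₀ α Kb Ka Eb Et M t Node Hull j := by
  intro s S hs hsh hnode hrun _hM
  have hKK : 0 ≤ Ka + Kb + 1 := by omega
  set h := t (j + 1) - t j with hh
  obtain ⟨ψ, hψ0, hψd, hψT, hψN⟩ := hflow (slice S 0) (hN _ hnode)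
  -- weighted coordinates of the run and of the exact solution
  set f : ℝ → (Fin m × Fin (winLen Kb Ka) → ℝ) := fun u => pwcoord Kb Ka ω (slice S u) with hf
  set g : ℝ → (Fin m × Fin (winLen Kb Ka) → ℝ) := fun u => pwcoord Kb Ka ω (slice ψ u) with hg
  set v : (Fin m × Fin (winLen Kb Ka) → ℝ) → (Fin m × Fin (winLen Kb Ka) → ℝ) :=
    fun x => pwcoord Kb Ka ω (truncField 𝕊 ε₀ α Kb Ka (pwstate Kb Ka ω x)) with hv
  set T : Set (Fin m × Fin (winLen Kb Ka) → ℝ) := {x | InBoxOn Kb Ka glo ghi (pwstate Kb Ka ω x)} with hT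
  -- Lipschitz bound of `v` on `T`
  have hvlip : LipschitzOnWith K.toNNReal v T := by
    refine LipschitzOnWith.of_dist_le_mul fun x hx x' hx' => ?_
    rw [Real.coe_toNNReal K hK]
    refine dist_pwcoord_le hω hKK (mul_nonneg hK dist_nonneg) fun i k hk1 hk2 => ?_
    have := hlip (pwstate Kb Ka ω x) (pwstate Kb Ka ω x') (dist x x') dist_nonneg hx hx'
      (fun i' k' hk1' hk2' => abs_pwstate_sub_le hω hKK x x' i' hk1' hk2') i k hk1 hk2
    exact this
  -- the run: derivative, continuity
  have hSd : ∀ u ∈ Ico 0 s, HasDerivWithinAt f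
      (pwcoord Kb Ka ω (fun i k => quadTermOn 𝕊 ε₀ α S i k u)) (Ici u) u := by
    intro u hu
    have hmem : Icc 0 s ∈ 𝓝[≥] u := mem_of_superset (Icc_mem_nhdsGE hu.2) (Icc_subset_Icc_left hu.1)
    refine HasDerivWithinAt.mono_of_mem_nhdsWithin ?_ hmem
    rw [hasDerivWithinAt_pi]
    intro c
    obtain ⟨h1, h2⟩ := shellAt_mem hKK c.2
    have := (hrun.deriv c.1 _ h1 h2 u (Ico_subset_Icc_self hu)).div_const (ω c.1 (shellAt Kb c.2))
    simpa [hf, pwcoord, slice] using this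
  have hSc : ContinuousOn f (Icc 0 s) := by
    rw [continuousOn_pi]
    intro c
    obtain ⟨h1, h2⟩ := shellAt_mem hKK c.2
    simpa [hf, pwcoord, slice] using (hrun.continuousOn c.1 h1 h2).div_const (ω c.1 (shellAt Kb c.2))
  -- the input defect of the run, WHERE the run lies in `G`
  have hSdef : ∀ u ∈ Ico 0 s, f u ∈ T →
      dist (pwcoord Kb Ka ω (fun i k => quadTermOn 𝕊 ε₀ α S i k u)) (v (f u)) ≤ δ := by
    intro u hu hfT
    have hu' := Ico_subset_Icc_self hu
    simp only [hv, hf]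
    rw [truncField_pwstate_pwcoord 𝕊 ε₀ α hω]
    refine dist_pwcoord_le hω hKK hδ fun i k hk1 hk2 => ?_
    have hY : InBoxOn Kb Ka glo ghi (slice S u) := by
      have := hfT
      simp only [hT, mem_setOf_eq, hf] at this
      intro i' k' hk1' hk2'
      have h' := this i' k' hk1' hk2'
      rwa [pwstate_pwcoord hω _ i' hk1' hk2'] at h'
    have := hdef (slice S u) hY (fun i' => by simpa [slice] using hrun.bound_bot i' u hu')
      (fun i' => by simpa [slice] using hrun.bound_top i' u hu') i k hk1 hk2
    rwa [quadTermOn_slice] at this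
  -- the exact solution: derivative, continuity, region (distance `0 ≤ A'` from the tube)
  have hA0 : 0 ≤ A := by
    have h0 : gronwallBound 0 K δ 0 ≤ gronwallBound 0 K δ h :=
      gronwallBound_mono hK hδ (by linarith)
    rw [gronwallBound_x0] at h0
    exact h0.trans hA
  have hA'0 : 0 ≤ A' := hA0.trans hAA'.le
  have hψd' : ∀ u ∈ Ico 0 s, HasDerivWithinAt g (v (g u)) (Ici u) u := by
    intro u hu
    have hus : u < h := lt_of_lt_of_le hu.2 hsh
    have hmem : Icc 0 h ∈ 𝓝[≥] u := mem_of_superset (Icc_mem_nhdsGE hus) (Icc_subset_Icc_left hu.1)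
    refine HasDerivWithinAt.mono_of_mem_nhdsWithin ?_ hmem
    rw [hasDerivWithinAt_pi]
    intro c
    obtain ⟨h1, h2⟩ := shellAt_mem hKK c.2
    have := (hψd c.1 _ h1 h2 u ⟨hu.1, hus.le⟩).div_const (ω c.1 (shellAt Kb c.2))
    simp only [hv, hg]
    rw [truncField_pwstate_pwcoord 𝕊 ε₀ α hω]
    simpa [pwcoord, slice] using this
  have hψc : ContinuousOn g (Icc 0 s) := by
    rw [continuousOn_pi]
    intro c
    obtain ⟨h1, h2⟩ := shellAt_mem hKK c.2
    have : ContinuousOn (ψ c.1 (shellAt Kb c.2)) (Icc 0 h) := fun u hu =>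
      (hψd c.1 _ h1 h2 u hu).continuousWithinAt
    simpa [hg, pwcoord, slice] using
      (this.mono (Icc_subset_Icc_right hsh)).div_const (ω c.1 (shellAt Kb c.2))
  -- states within weighted distance `A'` of the exact solution are in `G`
  have hnearT : ∀ u ∈ Icc 0 s, ∀ x : Fin m × Fin (winLen Kb Ka) → ℝ, dist x (g u) ≤ A' → x ∈ T := by
    intro u hu x hx
    have hu' : u ∈ Icc 0 h := ⟨hu.1, hu.2.trans hsh⟩
    show InBoxOn Kb Ka glo ghi (pwstate Kb Ka ω x)
    refine hGT' u hu' (slice ψ u) _ (hψT u hu') fun i k hk1 hk2 => ?_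
    have h1 := abs_pwstate_sub_le hω hKK x (g u) i hk1 hk2
    simp only [hg, pwstate_pwcoord hω _ i hk1 hk2, slice_apply] at h1
    exact h1.trans (mul_le_mul_of_nonneg_right hx (hω i k).le)
  have hψT' : ∀ u ∈ Ico 0 s, g u ∈ T := fun u hu =>
    hnearT u (Ico_subset_Icc_self hu) (g u) (by rw [dist_self]; exact hA'0)
  have hψdef : ∀ u ∈ Ico 0 s, dist (v (g u)) (v (g u)) ≤ 0 := fun u _ => by rw [dist_self]
  -- same start
  have h0 : dist (f 0) (g 0) ≤ 0 := by
    refine le_of_eq (dist_eq_zero.2 ?_)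
    funext c
    obtain ⟨h1, h2⟩ := shellAt_mem hKK c.2
    simp only [hf, hg, pwcoord, slice_apply, hψ0 c.1 _ h1 h2]
  -- Grönwall on `[0, b]` PROVIDED the run lies in `G` on `[0, b)`
  have key : ∀ b, b ≤ s → (∀ u ∈ Ico 0 b, f u ∈ T) →
      ∀ u ∈ Icc 0 b, dist (f u) (g u) ≤ gronwallBound 0 K δ u := by
    intro b hb hfT u hu
    have hsub : Ico 0 b ⊆ Ico 0 s := Ico_subset_Ico_right hb
    have hgr := dist_le_of_approx_trajectories_ODE_of_mem (v := fun _ => v) (s := fun _ => T)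
      (fun u _ => hvlip) (hSc.mono (Icc_subset_Icc_right hb)) (fun u hu => hSd u (hsub hu))
      (fun u hu => hSdef u (hsub hu) (hfT u hu)) hfT (hψc.mono (Icc_subset_Icc_right hb))
      (fun u hu => hψd' u (hsub hu)) (fun u hu => hψdef u (hsub hu)) (fun u hu => hψT' u (hsub hu)) h0 u hu
    rw [add_zero, sub_zero, Real.coe_toNNReal K hK] at hgr
    exact hgr
  -- continuity of the distance
  have hdc : ContinuousOn (fun u => dist (f u) (g u)) (Icc 0 s) :=
    continuous_dist.comp_continuousOn (hSc.prodMk hψc)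
  -- FIRST EXIT: the distance never reaches `A'` on `[0, s]`
  have hlt : ∀ u ∈ Icc 0 s, dist (f u) (g u) < A' := by
    by_contra hcon
    push Not at hcon
    set B : Set ℝ := Icc 0 s ∩ (fun u => dist (f u) (g u)) ⁻¹' Ici A' with hB
    have hBc : IsClosed B := hdc.preimage_isClosed_of_isClosed isClosed_Icc isClosed_Ici
    have hBne : B.Nonempty := by
      obtain ⟨u₀, hu₀, hd⟩ := hcon
      exact ⟨u₀, hu₀, hd⟩
    have hBbdd : BddBelow B := ⟨0, fun u hu => hu.1.1⟩
    set u₁ := sInf B with hu₁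
    have hu₁B : u₁ ∈ B := hBc.csInf_mem hBne hBbdd
    have hu₁s : u₁ ∈ Icc 0 s := hu₁B.1
    have hbefore : ∀ u ∈ Ico 0 u₁, f u ∈ T := by
      intro u hu
      have hus : u ∈ Icc 0 s := ⟨hu.1, hu.2.le.trans hu₁s.2⟩
      have hnot : u ∉ B := fun huB => absurd (csInf_le hBbdd huB) (not_le.mpr hu.2)
      have hdu : dist (f u) (g u) < A' := by
        by_contra hge
        push Not at hge
        exact hnot ⟨hus, hge⟩
      exact hnearT u hus (f u) hdu.le
    have hd₁ := key u₁ hu₁s.2 hbefore u₁ ⟨hu₁s.1, le_rfl⟩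
    have hgb : gronwallBound 0 K δ u₁ ≤ A := (gronwallBound_mono hK hδ (hu₁s.2.trans hsh)).trans hA
    have : A' ≤ dist (f u₁) (g u₁) := hu₁B.2
    linarith
  -- hence the run stays in `G` on `[0, s)` and Grönwall applies on the whole step
  have hfT : ∀ u ∈ Ico 0 s, f u ∈ T := fun u hu =>
    hnearT u (Ico_subset_Icc_self hu) (f u) (hlt u (Ico_subset_Icc_self hu)).le
  have hdev : ∀ u ∈ Icc 0 s, ∀ i k, -Kb ≤ k → k ≤ Ka → |S i k u - ψ i k u| ≤ A * ω i k := by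
    intro u hu i k hk1 hk2
    have h1 := abs_sub_le_dist_pwcoord hω hKK (slice S u) (slice ψ u) i hk1 hk2
    simp only [slice_apply] at h1
    have h2 := key s le_rfl hfT u hu
    have h3 : gronwallBound 0 K δ u ≤ A := (gronwallBound_mono hK hδ (hu.2.trans hsh)).trans hA
    calc |S i k u - ψ i k u| ≤ dist (f u) (g u) * ω i k := h1
      _ ≤ A * ω i k := mul_le_mul_of_nonneg_right (h2.trans h3) (hω i k).le
  refine ⟨fun u hu => hH u ⟨hu.1, hu.2.trans hsh⟩ _ (slice ψ u) (hψT u ⟨hu.1, hu.2.trans hsh⟩)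
      fun i k hk1 hk2 => ?_, fun hsfull => hN' _ (slice ψ h) hψN fun i k hk1 hk2 => ?_⟩
  · simpa [slice_apply] using hdev u hu i k hk1 hk2
  · have hd := hdev s ⟨hs.le, le_rfl⟩ i k hk1 hk2
    simpa [slice_apply, ← hsfull] using hd

/-! ### XIX-d: the per-component Lohner step with a bootstrap region -/

/-- **`StepCert` FROM A LOHNER-CHAIN CERTIFICATE STEP, PER-COMPONENT WEIGHTS, REGION = MAJORANT BALL ⊕ `A'`**
(glue XIX-c `stepCert_of_plohner_approx` with `hMR : M ≤ R·ω` replaced by `hR : R_h + A' ≤ R`, `A < A'`).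
[cite: Zgliczynski2002C1Lohner, §3–4 (Lohner-type parallelepiped frames and the C¹/variational enclosure); cell certificate format, Lohner step] -/
theorem stepCert_of_plohner_local_approx (hKb : 0 ≤ Kb) (hKa : 1 ≤ Ka) (hε : 0 < 1 + ε₀) (hω : ∀ i k, 0 < ω i k)
    {M : ℤ → ℝ} {t : ℕ → ℝ} {Node Hull : ℕ → (Fin m → ℤ → ℝ) → Prop} {j p : ℕ}
    {b mC ρC E₀ E₁ dP NVh κI R δ A A' : ℝ} {x x' : Fin (m * winLen Kb Ka) → ℝ}
    {C Cn Cin : Matrix (Fin (m * winLen Kb Ka)) (Fin (m * winLen Kb Ka)) ℝ} {r r' : Fin (m * winLen Kb Ka) → ℝ}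
    (hb : 0 ≤ b) (hmC : 0 ≤ mC) (hρC : 0 ≤ ρC) (hE₀ : 0 ≤ E₀) (hδ : 0 ≤ δ) (hAA' : A < A')
    (hh : 0 ≤ t (j + 1) - t j) (hguard : b * (mC + (ρC + E₀)) * (t (j + 1) - t j) < 1)
    (hB : ∀ i k, -Kb ≤ k → k ≤ Ka →
      ∑ i₁ : Fin m, ∑ i₂ : Fin m, ∑ μ ∈ 𝕊,
        |α i₁ i₂ i μ| * (1 + ε₀) ^ ((5 : ℝ) * (k - μ.2.2) / 2) *
          (pwExt Kb Ka ω i₁ (k - μ.2.2 + μ.1) * pwExt Kb Ka ω i₂ (k - μ.2.2 + μ.2.1)) ≤ b * ω i k)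
    (hx : ∀ c, |x c| ≤ mC)
    (hC : ∀ ξ : Fin (m * winLen Kb Ka) → ℝ, (∀ c, |ξ c| ≤ r c) → ∀ c, |C.mulVec ξ c| ≤ ρC)
    (hdP : ∀ c, |TPoly (PQcN 𝕊 ε₀ α Kb Ka ω) p x (t (j + 1) - t j) c - x' c| ≤ dP)
    (hNVh : ∀ (v : Fin (m * winLen Kb Ka) → ℝ) (N : ℝ), 0 ≤ N → (∀ c, |v c| ≤ N) →
      ∀ c, |VPoly (PQcN 𝕊 ε₀ α Kb Ka ω) p x v (t (j + 1) - t j) c| ≤ NVh * N)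
    (hframe : ∀ ξ : Fin (m * winLen Kb Ka) → ℝ, (∀ c, |ξ c| ≤ r c) →
      ∀ c, |Cin.mulVec (VPoly (PQcN 𝕊 ε₀ α Kb Ka ω) p x (C.mulVec ξ) (t (j + 1) - t j)) c| ≤ r' c)
    (hinv : ∀ ξ : Fin (m * winLen Kb Ka) → ℝ, (∀ c, |ξ c| ≤ r c) → ∀ c,
      |(Cn.mulVec (Cin.mulVec (VPoly (PQcN 𝕊 ε₀ α Kb Ka ω) p x (C.mulVec ξ) (t (j + 1) - t j))) -
        VPoly (PQcN 𝕊 ε₀ α Kb Ka ω) p x (C.mulVec ξ) (t (j + 1) - t j)) c| ≤ κI)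
    (hE₁ : κI + dP + NVh * E₀ + mC * (b * mC * (t (j + 1) - t j)) ^ (p + 1) / (1 - b * mC * (t (j + 1) - t j)) +
      (ρC + E₀) * ((((p : ℝ) + 2) * (b * mC * (t (j + 1) - t j)) ^ (p + 1) -
        ((p : ℝ) + 1) * (b * mC * (t (j + 1) - t j)) ^ (p + 2)) / (1 - b * mC * (t (j + 1) - t j)) ^ 2) +
      ((mC + (ρC + E₀)) / (1 - b * (mC + (ρC + E₀)) * (t (j + 1) - t j)) - mC / (1 - b * mC * (t (j + 1) - t j)) -
        (ρC + E₀) / (1 - b * mC * (t (j + 1) - t j)) ^ 2) ≤ E₁)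
    (hR : (mC + (ρC + E₀)) / (1 - b * (mC + (ρC + E₀)) * (t (j + 1) - t j)) + A' ≤ R)
    (hdef : PInputDefectOn 𝕊 ε₀ α Kb Ka Eb Et ω (fun i k => -(R * ω i k)) (fun i k => R * ω i k) δ)
    (hA : gronwallBound 0 (2 * b * R) δ (t (j + 1) - t j) ≤ A)
    (hN : ∀ y, Node j y → PInPara Kb Ka ω x C r E₀ y)
    (hH : ∀ y : Fin m → ℤ → ℝ, (∀ i k, -Kb ≤ k → k ≤ Ka →
      |y i k| ≤ ((mC + (ρC + E₀)) / (1 - b * (mC + (ρC + E₀)) * (t (j + 1) - t j)) + A) * ω i k) → Hull j y)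
    (hN' : ∀ y, PInPara Kb Ka ω x' Cn r' (E₁ + A) y → Node (j + 1) y) :
    StepCert 𝕊 ε₀ α Kb Ka Eb Et M t Node Hull j := by
  have hKK : 0 ≤ Ka + Kb + 1 := by omega
  set h := t (j + 1) - t j with hhdef
  set ρ := ρC + E₀ with hρdef
  have hρ0 : 0 ≤ ρ := by positivity
  set Rh := (mC + ρ) / (1 - b * (mC + ρ) * h) with hRh
  have hden : 0 < 1 - b * (mC + ρ) * h := by linarith
  have hRh0 : 0 ≤ Rh := div_nonneg (by positivity) hden.le
  have hA0 : 0 ≤ A := (gronwallBound_nonneg_of_zero hδ hh).trans hA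
  have hR0 : 0 ≤ R := by linarith [hRh0, hA0, hAA'.le]
  have hBQ := pqcN_bound_of_table (𝕊 := 𝕊) (ε₀ := ε₀) (α := α) hε hω hKK hB
  have hflow := plohner_flow (𝕊 := 𝕊) (ε₀ := ε₀) (α := α) (Land := PInPara Kb Ka ω x' Cn r' E₁) hKb hKa hε hω
    hb hmC hρC hE₀ hh hguard hB hx hC (fun ξ e hξ he ψ hψ0 hψd => pinPara_of_coords hω hKK
      (lohner_land_approx isLinearMap_PQcN_right isLinearMap_PQcN_left hb hBQ hh hmC hρC hE₀ hx hguard hC hdP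
        hNVh hframe hinv hE₁ ξ e hξ he ψ hψ0 hψd))
  refine stepCert_of_flowTube_local (Start := PInPara Kb Ka ω x C r E₀) (Land := PInPara Kb Ka ω x' Cn r' E₁)
    (Tube := fun (_ : ℝ) (q : Fin m → ℤ → ℝ) => ∀ i k, -Kb ≤ k → k ≤ Ka → |q i k| ≤ Rh * ω i k)
    (glo := fun i k => -(R * ω i k)) (ghi := fun i k => R * ω i k)
    hKb hKa hω (by positivity : 0 ≤ 2 * b * R) hδ hAA' hN (fun u _ q y hq hnear i k hk1 hk2 => ?_)
    (pfieldLipOn_ball hε hω hR0 hB) hdef hflow hA (fun u _ y q hq hnear => hH y fun i k hk1 hk2 => ?_)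
    (fun y q hq hnear => hN' y (pinPara_of_near hω hKK hq hnear))
  · have h1 := abs_le.mp (hq i k hk1 hk2)
    have h2 := abs_le.mp (hnear i k hk1 hk2)
    have h3 : (Rh + A') * ω i k ≤ R * ω i k := mul_le_mul_of_nonneg_right hR (hω i k).le
    constructor <;> nlinarith [h1.1, h1.2, h2.1, h2.2, h3, (hω i k).le]
  · have h1 := hq i k hk1 hk2
    have h2 := abs_le.mp (hnear i k hk1 hk2)
    rw [abs_le] at h1 ⊢
    constructor <;> nlinarith [h1.1, h1.2, h2.1, h2.2, (hω i k).le]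

end CertificateGlueOn

end Summit.NavierStokesRegularity.NavierStokesRegularity.Theorems

end
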